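import Summits.BirchSwinnertonDyer.BirchSwinnertonDyer.Theorems.ClassRecordThreeEulerHalvesAtThreeCartanTransportResidueIndex
import Summits.BirchSwinnertonDyer.BirchSwinnertonDyer.Theorems.ClassRecordThreeEulerHalvesAtThreeCartanTorusCubeCutTori
import HarnessLib

/-!
# TRANSPORT behind NUM, brick H2 (structure half): `ψ_q(O) = 𝔽_q[η_q]` with `η_q` of no rational eigenvalue, and the PINNING of `O` inside `O₀`

Helper file `--supports stmt-BirchSwinnertonDyer-19109 --as helper` (seat `bsd-idea-10` g17, lens transfer; crux `EulerHalvesAtThree` ∕ residue crux 23422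
line `cartan`, node (F2b♮) ⟺ NUM; road memo `Cruxes/EulerHalvesAtThree/TRANSPORT-HULL.md` §3.5, brick H2 = «residue description of the Cartan order
from the five axioms» — this is the STRUCTURE half; the counting half `|ψ_q(O)| = q²` is `…CartanTransportResidueIndex`).
SETTING: `X : CartanLevelCurveData D M C`, `q ∈ C`, a residue model `ψ : B → M₂(𝔽_q)` of the hull `O₀` (`IsMatrixResidueMap`, brick H1); the residue
algebra `k := ψ(O) = ((O.addSubgroupOf O₀).map ψ)` (spelled out, no new definition). THIS FILE (all PROVED):
* `exists_mul_eq_one_of_mem_image` — `k ∖ 0` consists of units with inverses in `k` (= the DIVISION axiom `isDivisionRing_mod` read through `ψ`);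
* `not_hasRatEigenvalue_of_mem_image` — a NON-SCALAR `η ∈ k` has NO RATIONAL EIGENVALUE (a root `x` of `X² − tr η X + det η` factors
  `(η − x)(η − (tr η − x)) = 0` in `k` (Cayley–Hamilton), contradicting the division property);
* `exists_mem_image_not_isScalarMat` — `k` contains a non-scalar element (`|k| = q² > q`);
* **`mem_image_iff_exists_lin`** — `k = 𝔽_q[η] = {a·1 + t·η}` for any non-scalar `η ∈ k` (both have `q²` elements; tree `lin_injective`), packaged as
  **`exists_eta`**: `∃ η, ¬ HasRatEigenvalue η ∧ (∀ m, m ∈ k ↔ ∃ c, m = lin η c)` — exactly the input shape of brick F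
  (`CartanTransport.ResidueField.exists_det_one_conj_field`, `conj_mem_field_iff`);
* **`mem_level_iff_exists_lin`** — SINGLE-PRIME PINNING: for `x ∈ O₀`, `x ∈ O + q O₀ ↔ ψ x ∈ 𝔽_q[η]`;
* **`mem_O_iff_of_pinning`** — ALL-PRIME PINNING from the SATURATED axiom: if predicates `P_p` (`p ∈ C`) describe the level groups
  (`x ∈ O + p O₀ ↔ P_p x` on `O₀`), then `x ∈ O ↔ x ∈ O₀ ∧ ∀ p ∈ C, P_p x`; with `P_p x := ψ_p x ∈ 𝔽_p[η_p]` this is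
  `O = {x ∈ O₀ : ψ_p(x) ∈ 𝔽_p[η_p] ∀ p ∈ C}` (`mem_O_iff_residues`, stated for any family of residue models handed in through their pinning property,
  with `a·1 + t·η` spelled out since `lin` wants a prime index; `lin_eq` is the `rfl` bridge).
USE (brick A of the memo; LEAD tam3-p1 g26 D1): two Cartan orders in one hull with the same residue fields coincide; conjugating by a norm-one hull unit
with prescribed residues (bricks F + S) matches the fields. For the LEAD's `CoverReduction X q` the fields `η`, `mem_O_iff` are `exists_eta` +
`mem_O_iff_residues` restricted to `coverOrder X q` (index prime to `q`, H1 `isMatrixResidueMap_of_le`).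
HONEST FRAMING: finite algebra; nothing about NUM, crux 23422 ∕ 19109 or any summit statement is proved by this seat; BSD is proved for no curve. [folklore]
-/

set_option linter.dupNamespace false
set_option autoImplicit false

noncomputable section

namespace Summit.BirchSwinnertonDyer.BirchSwinnertonDyer.Theorems.CartanTransport.ResiduePinning

open Literature.NumberTheory.Automorphic
open Summit.BirchSwinnertonDyer.BirchSwinnertonDyer.Theorems.CartanDegree (IsScalarMat HasRatEigenvalue)
open Summit.BirchSwinnertonDyer.BirchSwinnertonDyer.Theorems.CartanTorusCubeCut (Mat lin lin_injective)

variable {D M : ℕ} {C : Finset ℕ}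

/-! ## §1 Division property of the residue algebra -/

/-- PROVED — **`ψ(O) ∖ 0 ⊆ ψ(O)ˣ`**: a non-zero residue `m = ψ a`, `a ∈ O`, has a right inverse in `ψ(O)` — the DIVISION axiom `isDivisionRing_mod`
of the Cartan datum (`a ∉ q O₀`, so `a z ≡ 1 (mod q O₀)` for some `z ∈ O`). [folklore] -/
theorem exists_mul_eq_one_of_mem_image (X : CartanLevelCurveData D M C) {q : ℕ} [Fact q.Prime] (hq : q ∈ C)
    {ψ : X.B → Matrix (Fin 2) (Fin 2) (ZMod q)} (h : IsMatrixResidueMap X.O₀ q ψ) {m : Matrix (Fin 2) (Fin 2) (ZMod q)}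
    (hm : m ∈ (X.O.toAddSubgroup.addSubgroupOf X.O₀.toAddSubgroup).map h.addHom) (hm0 : m ≠ 0) :
    ∃ m' ∈ (X.O.toAddSubgroup.addSubgroupOf X.O₀.toAddSubgroup).map h.addHom, m * m' = 1 := by
  obtain ⟨a, ha, rfl⟩ := (ResidueIndex.mem_image_iff h X.le).mp hm
  have hnd : ¬ ∃ y ∈ X.O₀, a = (q : ℤ) • y := by
    rintro ⟨y, hy, rfl⟩
    exact hm0 (h.map_smul_eq_zero hy)
  obtain ⟨z, hz, y, hy, hazy⟩ := X.isDivisionRing_mod q hq a ha hnd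
  refine ⟨ψ z, (ResidueIndex.mem_image_iff h X.le).mpr ⟨z, hz, rfl⟩, ?_⟩
  have haz : a * z = 1 + (q : ℤ) • y := by rw [← hazy]; abel
  rw [← h.map_mul a (X.le ha) z (X.le hz), haz, h.map_add 1 X.isEichlerOrder.isOrder.one_mem _ (X.O₀.smul_mem _ hy), h.map_one,
    h.map_smul_eq_zero hy, add_zero]

/-! ## §2 Non-scalar residues have no rational eigenvalue -/

/-- PROVED: a scalar multiple of `1` is a scalar matrix. [folklore] -/
theorem isScalarMat_smul_one {q : ℕ} (c : ZMod q) : IsScalarMat (c • (1 : Matrix (Fin 2) (Fin 2) (ZMod q))) := by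
  refine ⟨?_, ?_, ?_⟩ <;> simp [Matrix.one_apply_ne, Matrix.one_apply_eq]

/-- PROVED — **a non-scalar element of the residue algebra `ψ(O)` has NO RATIONAL EIGENVALUE**: a root `x ∈ 𝔽_q` of `X² − tr η·X + det η` gives the
factorisation `(η − x·1)(η − (tr η − x)·1) = 0` with both factors non-zero elements of `ψ(O)`, against the division property. [folklore] -/
theorem not_hasRatEigenvalue_of_mem_image (X : CartanLevelCurveData D M C) {q : ℕ} [Fact q.Prime] (hq : q ∈ C)
    {ψ : X.B → Matrix (Fin 2) (Fin 2) (ZMod q)} (h : IsMatrixResidueMap X.O₀ q ψ) {η : Mat q}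
    (hη : η ∈ (X.O.toAddSubgroup.addSubgroupOf X.O₀.toAddSubgroup).map h.addHom) (hns : ¬ IsScalarMat η) :
    ¬ HasRatEigenvalue η := by
  rintro ⟨x, hx⟩
  have hT1 : ∀ c : ZMod q, c • (1 : Mat q) ∈ (X.O.toAddSubgroup.addSubgroupOf X.O₀.toAddSubgroup).map h.addHom :=
    ResidueIndex.smul_one_mem_image h X.le X.isOrder.one_mem
  have hscal : ∀ c : ZMod q, η - c • 1 ≠ 0 := fun c hc => hns (by rw [sub_eq_zero.mp hc]; exact isScalarMat_smul_one c)
  have hm₁ := AddSubgroup.sub_mem _ hη (hT1 x)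
  have hm₂ := AddSubgroup.sub_mem _ hη (hT1 (η.trace - x))
  have hprod : (η - x • (1 : Mat q)) * (η - (η.trace - x) • (1 : Mat q)) = 0 := by
    rw [Matrix.det_fin_two, Matrix.trace_fin_two] at hx
    ext i j
    rw [Matrix.trace_fin_two]
    fin_cases i <;> fin_cases j <;> simp [Matrix.mul_apply, Fin.sum_univ_two, Matrix.one_apply] <;>
      first | ring1 | linear_combination -hx
  obtain ⟨m', -, hmm'⟩ := exists_mul_eq_one_of_mem_image X hq h hm₁ (hscal x)
  have h' : m' * (η - x • (1 : Mat q)) = 1 := mul_eq_one_comm.mp hmm'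
  refine hscal (η.trace - x) ?_
  have hm : m' * ((η - x • (1 : Mat q)) * (η - (η.trace - x) • (1 : Mat q))) = m' * 0 := congrArg (fun n : Mat q => m' * n) hprod
  rwa [← mul_assoc, h', one_mul, mul_zero] at hm

/-! ## §3 `ψ(O) = 𝔽_q[η]` -/

/-- PROVED — **`ψ(O)` contains a non-scalar matrix** (`|ψ(O)| = q² > q = |𝔽_q·1|`). [folklore] -/
theorem exists_mem_image_not_isScalarMat (X : CartanLevelCurveData D M C) {q : ℕ} [Fact q.Prime] (hq : q ∈ C)
    {ψ : X.B → Matrix (Fin 2) (Fin 2) (ZMod q)} (h : IsMatrixResidueMap X.O₀ q ψ) :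
    ∃ η ∈ (X.O.toAddSubgroup.addSubgroupOf X.O₀.toAddSubgroup).map h.addHom, ¬ IsScalarMat η := by
  by_contra hall
  simp only [not_exists, not_and, not_not] at hall
  have hinj : Function.Injective
      (fun m : ((X.O.toAddSubgroup.addSubgroupOf X.O₀.toAddSubgroup).map h.addHom) => (m : Mat q) 0 0) := by
    rintro ⟨m, hm⟩ ⟨m', hm'⟩ hmm
    obtain ⟨h01, h10, h00⟩ := hall m hm
    obtain ⟨h01', h10', h00'⟩ := hall m' hm'
    have e00 : m 0 0 = m' 0 0 := hmm
    have e01 : m 0 1 = m' 0 1 := by rw [h01, h01']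
    have e10 : m 1 0 = m' 1 0 := by rw [h10, h10']
    have e11 : m 1 1 = m' 1 1 := by rw [← h00, ← h00', e00]
    exact Subtype.ext (Matrix.ext fun i j => by
      fin_cases i <;> fin_cases j <;> first | exact e00 | exact e01 | exact e10 | exact e11)
  have hle := Nat.card_le_card_of_injective _ hinj
  rw [ResidueIndex.natCard_image_eq X hq h, Nat.card_zmod] at hle
  have hq2 : 2 ≤ q := (Fact.out : q.Prime).two_le
  nlinarith [hle, hq2]

/-- PROVED — **`ψ(O) = 𝔽_q[η] = {a·1 + t·η}` for any non-scalar `η ∈ ψ(O)`** (`⊇`: `ψ(O)` is an `𝔽_q`-algebra; `⊆`: both sides have `q²`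
elements, `(a,t) ↦ a·1 + t·η` being injective by the tree's `lin_injective`). [folklore] -/
theorem mem_image_iff_exists_lin (X : CartanLevelCurveData D M C) {q : ℕ} [Fact q.Prime] (hq : q ∈ C)
    {ψ : X.B → Matrix (Fin 2) (Fin 2) (ZMod q)} (h : IsMatrixResidueMap X.O₀ q ψ) {η : Mat q}
    (hη : η ∈ (X.O.toAddSubgroup.addSubgroupOf X.O₀.toAddSubgroup).map h.addHom) (hns : ¬ IsScalarMat η) (m : Mat q) :
    m ∈ (X.O.toAddSubgroup.addSubgroupOf X.O₀.toAddSubgroup).map h.addHom ↔ ∃ c : ZMod q × ZMod q, m = lin η c := by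
  have hηr := not_hasRatEigenvalue_of_mem_image X hq h hη hns
  have hlin : ∀ c : ZMod q × ZMod q, lin η c ∈ (X.O.toAddSubgroup.addSubgroupOf X.O₀.toAddSubgroup).map h.addHom := fun c =>
    AddSubgroup.add_mem _ (ResidueIndex.smul_one_mem_image h X.le X.isOrder.one_mem c.1)
      (ResidueIndex.smul_mem_image h X.le X.isOrder.one_mem X.isOrder.mul_mem c.2 hη)
  constructor
  · intro hm
    have hinj : Function.Injective (fun c : ZMod q × ZMod q =>
        (⟨lin η c, hlin c⟩ : ((X.O.toAddSubgroup.addSubgroupOf X.O₀.toAddSubgroup).map h.addHom))) :=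
      fun c c' hcc => lin_injective hηr (congrArg Subtype.val hcc)
    have hcard : Nat.card ((X.O.toAddSubgroup.addSubgroupOf X.O₀.toAddSubgroup).map h.addHom) ≤ Nat.card (ZMod q × ZMod q) := by
      rw [ResidueIndex.natCard_image_eq X hq h, Nat.card_prod, Nat.card_zmod, pow_two]
    obtain ⟨c, hc⟩ := (hinj.bijective_of_nat_card_le hcard).2 ⟨m, hm⟩
    exact ⟨c, (congrArg Subtype.val hc).symm⟩
  · rintro ⟨c, rfl⟩
    exact hlin c

/-- PROVED — **THE RESIDUE FIELD OF A CARTAN ORDER**: at every `q ∈ C` the residue algebra `ψ_q(O)` is `𝔽_q[η]` for a matrix `η` WITHOUT RATIONAL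
EIGENVALUE (a non-split Cartan subalgebra `𝔽_{q²} ⊂ M₂(𝔽_q)`). [folklore] -/
theorem exists_eta (X : CartanLevelCurveData D M C) {q : ℕ} [Fact q.Prime] (hq : q ∈ C)
    {ψ : X.B → Matrix (Fin 2) (Fin 2) (ZMod q)} (h : IsMatrixResidueMap X.O₀ q ψ) :
    ∃ η : Mat q, ¬ HasRatEigenvalue η ∧
      ∀ m : Mat q, m ∈ (X.O.toAddSubgroup.addSubgroupOf X.O₀.toAddSubgroup).map h.addHom ↔ ∃ c : ZMod q × ZMod q, m = lin η c := by
  obtain ⟨η, hη, hns⟩ := exists_mem_image_not_isScalarMat X hq h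
  exact ⟨η, not_hasRatEigenvalue_of_mem_image X hq h hη hns, mem_image_iff_exists_lin X hq h hη hns⟩

/-- PROVED: a generator `η` of the residue field lifts to the Cartan order: `η = ψ s` for some `s ∈ O`. [folklore] -/
theorem exists_lift_eta (X : CartanLevelCurveData D M C) {q : ℕ} [Fact q.Prime]
    {ψ : X.B → Matrix (Fin 2) (Fin 2) (ZMod q)} (h : IsMatrixResidueMap X.O₀ q ψ) {η : Mat q}
    (hT : ∀ m : Mat q, m ∈ (X.O.toAddSubgroup.addSubgroupOf X.O₀.toAddSubgroup).map h.addHom ↔ ∃ c : ZMod q × ZMod q, m = lin η c) :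
    ∃ s ∈ X.O, ψ s = η :=
  (ResidueIndex.mem_image_iff h X.le).mp ((hT η).mpr ⟨(0, 1), by simp [lin]⟩)

/-! ## §4 Pinning -/

/-- PROVED — **SINGLE-PRIME PINNING**: for `x ∈ O₀`, `x ∈ O + q O₀` iff `ψ x ∈ 𝔽_q[η]`. [folklore] -/
theorem mem_level_iff_exists_lin (X : CartanLevelCurveData D M C) {q : ℕ} [Fact q.Prime]
    {ψ : X.B → Matrix (Fin 2) (Fin 2) (ZMod q)} (h : IsMatrixResidueMap X.O₀ q ψ) {η : Mat q}
    (hT : ∀ m : Mat q, m ∈ (X.O.toAddSubgroup.addSubgroupOf X.O₀.toAddSubgroup).map h.addHom ↔ ∃ c : ZMod q × ZMod q, m = lin η c)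
    {x : X.B} (hx : x ∈ X.O₀) :
    (∃ a ∈ X.O, ∃ y ∈ X.O₀, x - a = (q : ℤ) • y) ↔ ∃ c : ZMod q × ZMod q, ψ x = lin η c := by
  rw [← hT (ψ x)]
  have hpre := ResidueIndex.mem_preim_image_iff h X.le (x := x)
  rw [h.mem_preim_iff] at hpre
  constructor
  · intro hxa
    exact (hpre.mpr ⟨hx, hxa⟩).2
  · intro hm
    exact (hpre.mp ⟨hx, hm⟩).2

/-- PROVED — **ALL-PRIME PINNING from SATURATION**: if predicates `P p` describe the level groups `O + p O₀` on `O₀` for every `p ∈ C`, then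
`O = {x ∈ O₀ : P p x for all p ∈ C}`. [folklore] -/
theorem mem_O_iff_of_pinning (X : CartanLevelCurveData D M C) (P : ℕ → X.B → Prop)
    (hP : ∀ p ∈ C, ∀ x ∈ X.O₀, ((∃ a ∈ X.O, ∃ y ∈ X.O₀, x - a = (p : ℤ) • y) ↔ P p x)) (x : X.B) :
    x ∈ X.O ↔ x ∈ X.O₀ ∧ ∀ p ∈ C, P p x := by
  constructor
  · intro hx
    exact ⟨X.le hx, fun p hp => (hP p hp x (X.le hx)).mp ⟨x, hx, 0, X.O₀.zero_mem, by rw [sub_self, smul_zero]⟩⟩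
  · rintro ⟨hx0, hx⟩
    exact X.saturated x hx0 fun p hp => (hP p hp x hx0).mpr (hx p hp)

/-- PROVED — **`O = {x ∈ O₀ : ψ_p(x) ∈ 𝔽_p[η_p] for all p ∈ C}`** for any family of residue models `ψ_p` of the hull with residue fields `𝔽_p[η_p]`
(handed in through their single-prime pinning property, `mem_level_iff_exists_lin`). [folklore] -/
theorem mem_O_iff_residues (X : CartanLevelCurveData D M C) (ψ : (p : ℕ) → X.B → Matrix (Fin 2) (Fin 2) (ZMod p))
    (η : (p : ℕ) → Matrix (Fin 2) (Fin 2) (ZMod p))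
    (hpin : ∀ p ∈ C, ∀ x ∈ X.O₀, ((∃ a ∈ X.O, ∃ y ∈ X.O₀, x - a = (p : ℤ) • y) ↔
      ∃ c : ZMod p × ZMod p, ψ p x = c.1 • (1 : Matrix (Fin 2) (Fin 2) (ZMod p)) + c.2 • η p)) (x : X.B) :
    x ∈ X.O ↔ x ∈ X.O₀ ∧ ∀ p ∈ C, ∃ c : ZMod p × ZMod p, ψ p x = c.1 • (1 : Matrix (Fin 2) (Fin 2) (ZMod p)) + c.2 • η p :=
  mem_O_iff_of_pinning X (fun p x => ∃ c : ZMod p × ZMod p, ψ p x = c.1 • (1 : Matrix (Fin 2) (Fin 2) (ZMod p)) + c.2 • η p) hpin x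

/-- PROVED: `lin η c = c.1 • 1 + c.2 • η` (the tree's `lin`, definitional) — the bridge between the single-prime statements (over `𝔽_q`, `q` prime) and
the all-prime statement `mem_O_iff_residues` (which cannot mention `lin`, a notion requiring primality of the index). [folklore] -/
theorem lin_eq {q : ℕ} [Fact q.Prime] (η : Mat q) (c : ZMod q × ZMod q) : lin η c = c.1 • (1 : Mat q) + c.2 • η := rfl

end Summit.BirchSwinnertonDyer.BirchSwinnertonDyer.Theorems.CartanTransport.ResiduePinning
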